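import Summits.BirchSwinnertonDyer.BirchSwinnertonDyer.Theorems.SignedLowerHalvesBDKimSignedCharValueRankZeroOfPoitouTateOdd
import Summits.BirchSwinnertonDyer.BirchSwinnertonDyer.Theorems.SchneiderFreeAdditiveX3PoitouTateSelmerDualityHolds
import HarnessLib

set_option linter.dupNamespace false -- `…BirchSwinnertonDyer.BirchSwinnertonDyer…` is the cell's nested layout (D-0017)
set_option autoImplicit false

/-!
# F10 (Kim 2013 Cor. 3.15, item 19288) ⟸ the SINGLE Poitou–Tate row PT-Ш(ℚ) — PT-Sel discharged
# (LADDER-BSD D-0154 (2), INPUTS-LIST-2 ADDENDUM-9 §0.11 entry T12)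

Seat `bsd-inputs-honda-p1` (gen 6, idle INPUTS prover of the desk `pub/bsd-wall/bsd-inputs`), `--supports`
stmt-BirchSwinnertonDyer-19288. THEOREMS ONLY (no definition, no named fact, no `sorry`); pure re-export, no new mathematics.

T9 (`Theorems/SignedLowerHalvesBDKimSignedCharValueRankZeroOfPoitouTateOdd.lean`, t9-p1 g0, p624074) proved
`KimCor315.cor315_of_poitouTate_two_rows (hPTs : poitouTate_selmerStructure_duality ℚ) (hPT : poitouTate_sha_tateDual ℚ) :
BDKim2013.cor315_signedCharValue_rankZero` and the three route doors. Since 2026-08-28T10:27Z the first row is a THEOREM OF THE TREE: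
`SchneiderFreeAdditiveX3.PoitouTateReduction.poitouTate_selmerStructure_duality_holds (K)` (cell `bsd-schneider`, door-c4 g18, p624636;
item 20461 closed by p625477). This file substitutes it: F10 and its three route declarations now follow from PT-Ш(ℚ) ALONE
(`poitouTate_sha_tateDual ℚ`, item 20462 — Milne *ADT* I Thm. 4.10 (a) / Tate 1962, still OPEN).

Honest framing: CONDITIONAL on the one remaining named fact PT-Ш(ℚ); item 19288 is NOT closed (it closes by a one-liner the day
20462 has a `_holds`); no crux and no summit statement is proved; BSD is not proved by any of this.
References: [BDKim2013] Cor. 3.15 (p. 199); [MilneADT2006] Ch. I, Thm. 4.10; [Howard2004HeegnerKolyvagin] Thm. 2.1.11.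
-/

noncomputable section

namespace Summit.BirchSwinnertonDyer.BirchSwinnertonDyer.Theorems.KimCor315

open Literature.NumberTheory.GaloisCohomology Literature.NumberTheory.EllipticCurves

/-- **F10 = Kim 2013 Cor. 3.15 (`BDKim2013.cor315_signedCharValue_rankZero`, item 19288's signature) ⟸ PT-Ш(ℚ) ALONE**:
`cor315_of_poitouTate_two_rows` with its PT-Sel row discharged by the tree theorem
`SchneiderFreeAdditiveX3.PoitouTateReduction.poitouTate_selmerStructure_duality_holds ℚ`. Conditional on `poitouTate_sha_tateDual ℚ`
(item 20462); closes nothing; BSD is not proved by this. [cite: BDKim2013, Cor. 3.15 (p. 199)] [cite: MilneADT2006, Ch. I, Thm. 4.10] -/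
theorem cor315_of_poitouTateSha (hPT : poitouTate_sha_tateDual ℚ) : BDKim2013.cor315_signedCharValue_rankZero :=
  cor315_of_poitouTate_two_rows (SchneiderFreeAdditiveX3.PoitouTateReduction.poitouTate_selmerStructure_duality_holds ℚ) hPT

/-- **Route `SignedLowerHalves`, support `BDKimSignedCharValueRankZero` (item 19288) ⟸ PT-Ш(ℚ) alone.** Conditional; the item is
not closed; BSD is not proved by this. [cite: BDKim2013, Cor. 3.15 (p. 199)] [cite: MilneADT2006, Ch. I, Thm. 4.10] -/
theorem signedLowerHalves_bdKimSignedCharValueRankZero_of_poitouTateSha (hPT : poitouTate_sha_tateDual ℚ) :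
    Summit.BirchSwinnertonDyer.BirchSwinnertonDyer.Theses.SignedLowerHalves.BDKimSignedCharValueRankZero :=
  cor315_of_poitouTateSha hPT

/-- **Route `SignedBaseChange`, support `BDKimSignedCharValueRankZero` (item 19288) ⟸ PT-Ш(ℚ) alone.** Conditional; the item is not
closed; BSD is not proved by this. [cite: BDKim2013, Cor. 3.15 (p. 199)] [cite: MilneADT2006, Ch. I, Thm. 4.10] -/
theorem signedBaseChange_bdKimSignedCharValueRankZero_of_poitouTateSha (hPT : poitouTate_sha_tateDual ℚ) :
    Summit.BirchSwinnertonDyer.BirchSwinnertonDyer.Theses.SignedBaseChange.BDKimSignedCharValueRankZero :=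
  cor315_of_poitouTateSha hPT

/-- **Route `PrintX6`, support `InputKimCor315` (item 19288) ⟸ PT-Ш(ℚ) alone.** Conditional; the item is not closed; BSD is not
proved by this. [cite: BDKim2013, Cor. 3.15 (p. 199)] [cite: MilneADT2006, Ch. I, Thm. 4.10] -/
theorem printX6_inputKimCor315_of_poitouTateSha (hPT : poitouTate_sha_tateDual ℚ) :
    Summit.BirchSwinnertonDyer.BirchSwinnertonDyer.Theses.PrintX6.InputKimCor315 :=
  cor315_of_poitouTateSha hPT

/-! ## Appendix (INPUTS-LIST-2 ADD-10 §A T12, plan-2 g10 texts verbatim): the closers-in-waiting on the text of item 20462 -/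

/-- **Cor. 3.15 BY NAME from the text of item stmt-BirchSwinnertonDyer-20462 `PoitouTateShaTateDualFact` VERBATIM**
(`∀ K, poitouTate_sha_tateDual K`, specialised at `K = ℚ`). CONDITIONAL; the closing one-liner for 19288 the day 20462 is discharged.
[cite: BDKim2013, Cor. 3.15 (p. 199)] [cite: MilneADT2006, Ch. I, Thm. 4.10 (a)] -/
theorem cor315_of_poitouTateShaFact
    (hPT : ∀ (K : Type) [Field K] [NumberField K], poitouTate_sha_tateDual K) :
    BDKim2013.cor315_signedCharValue_rankZero :=
  cor315_of_poitouTateSha (hPT ℚ)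

/-- **Route `SignedLowerHalves`, item 19288 BY NAME ⟸ the text of item 20462 VERBATIM** (the closer-in-waiting).
CONDITIONAL; does not close the item. [cite: BDKim2013, Cor. 3.15 (p. 199)] [cite: MilneADT2006, Ch. I, Thm. 4.10 (a)] -/
theorem signedLowerHalves_bdKimSignedCharValueRankZero_of_poitouTateShaFact
    (hPT : ∀ (K : Type) [Field K] [NumberField K], poitouTate_sha_tateDual K) :
    Summit.BirchSwinnertonDyer.BirchSwinnertonDyer.Theses.SignedLowerHalves.BDKimSignedCharValueRankZero :=
  cor315_of_poitouTateSha (hPT ℚ)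

end Summit.BirchSwinnertonDyer.BirchSwinnertonDyer.Theorems.KimCor315

end
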